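/-
Copyright (c) 2026 the pub-hodgecm-mathlib formalisation cell (harness21).  Prover seat hodgecm-mathlib-K2E3-p11 (g7), Track B «K2-LIT» ∕ h413
(`stmt-HodgeConjecture-24833`), line `K2_E3_EllipticInputs`, leaf (nsc-S-A′), C1′ (S-A′-C1low) file L3 «S0IRR♭»: the quotient `S♭ = I(A) ⁄ Φ(D♭)` is irreducible
(architect K2E3-p25 (g3) file list 2026-09-04T14:45:25Z; C1″ mirror = K2E3-p27 (g0)'s FILE 2 «S0IRR»).  2026-09-04.
-/
import Summits.HodgeConjecture.HodgeConjecture.Theorems.K2E3GL3OneLinkNestedLowAmbient        -- ★ L2 (architect K2E3-p25 (g3)): the `S♭`-table, smoothness, admissibility, `h3cell` ⇒ `r_B ≠ 0` on constituents; brings ★ L1, ★ F7a (`isOpen_ker_a`), ★ H0, ★ GL2-UNL, ★ ADD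
import Summits.HodgeConjecture.HodgeConjecture.Theorems.K2E3GL3OneLinkNestedLowConstituentA   -- ★ L3a (this seat): `exists_constituent_A_one`
import Summits.HodgeConjecture.HodgeConjecture.Theorems.K2E3GL3ExponentClassTools             -- ★ C2b-gen (this seat): `nontrivial_of_finrank_weightSpace_ne_zero`, `bot_ne_top_subrepresentation`, `exists_finrank_weightSpace_ne_zero_of_ne_bot`
import Summits.HodgeConjecture.HodgeConjecture.Theorems.K2E3GL3PrincipalSeriesExhaustion        -- ★ EXH (K2E3-p24): `exists_finrank_weightSpace_quotientRep_ne_zero`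
import HarnessLib

/-!
# Crux `H413` — leaf (nsc-S-A′), C1′ (S-A′-C1low) file L3 «S0IRR♭»: THE QUOTIENT `S♭ = I(A) ⁄ Φ(D♭)` IS IRREDUCIBLE

Cell `hodgecm-mathlib`, Track B; THEOREMS ONLY; count-neutral helper (`--supports stmt-HodgeConjecture-24833 --as helper`).  Letters (★ L1∕L2, architect K2E3-p25 (g3)):
`a = η·ν^{-1∕2}`, `aν = η·ν^{1∕2}`, weights `A = tch(a, aν, a)`, `B = tch(a, a, aν)`, `C = tch(aν, a, a)`; `D♭ = D(η, ην^{-1∕2})`, `Φ : D♭ ↪ I(A)` injective,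
`S♭ := I(A) ⁄ range Φ` = `Φ.range.quotientRep`.  ★ L2 gives the table `mult S♭ B = 0`, `mult S♭ A ≤ 1`, `mult S♭ C = 2`, `= 0` off `{A, B, C}`, and that every constituent of `S♭` is
admissible with `r_B ≠ 0` (under the cell binder `h3cell`).

* **`isIrreducible_quotient`** — under `h3cell` and the letter **NAA♭** («no admissible irreducible `r` with `mult r A = 1` and every other weight `0`», binder `hNAA` = the C1″
  binder `hNYA` of ★ `K2E3GL3OneLinkNestedHigh` under `Y ↦ A`), `S♭` is IRREDUCIBLE.  PROOF (exponent bookkeeping only): for a subrepresentation `N` of `S♭` with `⊥ ≠ N ≠ ⊤`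
  both pieces `N`, `S♭⁄N` carry a weight (★ C2b-gen ∕ ★ EXH, fed by `h3cell`); `mult_P C` is EVEN for every smooth piece `P` (★ H0 `even_finrank_weightSpace₁₂`: the letters of
  `C = (aν, a, a)` in positions (1,2) coincide and `I₂(a, a)` is irreducible, ★ GL2-UNL), and `mult_N C + mult_{S♭⁄N} C = 2` (★ ADD), so one piece `P` has `mult_P C = 0`; its weights
  lie in those of `S♭` (★ ADD), so `E(P) ⊆ {A}` with `mult_P A ≤ 1`, hence `= 1` (it has a weight); ★ L3a `exists_constituent_A_one` then produces an irreducible constituent `ω` of `P`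
  with `E(ω) = {A¹}`, admissible as a constituent of `S♭` (★ L2) — against NAA♭.
Consumer: the C1′ payer ★∕📤 L4 `K2E3GL3OneLinkNestedLow.sAprimeC1low_of (hIRR♭) (hNAA) (hS♭)`, whose binder `hS♭ : ∀ η, IsOpen ker η → ∀ Φ hΦ, (Φ.range.quotientRep).IsIrreducible`
this file discharges modulo `h3cell` (the three-cell socket, ★) and NAA♭ (letter, K2E3-p03 (g8) D131).

HONEST LABEL: HC_CM is proved only modulo the 7 printed citations (2 remaining named inputs: hLiu418 = stmt-HodgeConjecture-24832, h413 =
stmt-HodgeConjecture-24833) until rung 0 closes; count-neutral helper.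

## Mathlib ∕ tree search
★ L2 `finrank_weightSpace_quotient_{B, A_le, C, eq_zero}`, `isSmooth_quotient`, `finiteDimensional_jacquet_quotient`, `nontrivial_coinvariants_of_isConstituentOf_quotient`,
`isAdmissible_of_isConstituentOf_quotient` · ★ F7a `isOpen_ker_a` · ★ H0 `even_finrank_weightSpace₁₂` · ★ GL2-UNL `isIrreducible_parabolicIndGL_two_self` · ★ ADD
`finrank_weightSpace_eq_add_subrepresentation`, `…_subrepresentation_le`, `…_quotientRep_le`, `finiteDimensional_jacquet_subrepresentation∕_quotientRep` · ★ EXH · ★ C2b-gen ·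
`continuous_unitsCoe_of_isOpen_ker` · ★ `IsConstituentOf.of_subrepresentation∕of_quotientRep`.  Dedup: `rg "isIrreducible_quotient" Theorems/K2E3GL3OneLinkNestedLow*` — none.

## References
* [BernsteinZelevinsky1977] I. N. Bernstein, A. V. Zelevinsky, *Induced representations of reductive p-adic groups I*, Ann. Sci. ÉNS 10 (1977), Cor. 2.13, Thm. 2.9, §2.3.
* [Zelevinsky1980] A. V. Zelevinsky, *Induced representations of reductive p-adic groups II*, Ann. Sci. ÉNS 13 (1980), §1.6, Ex. 3.2, Thm. 4.2.
* [Casselman1995] W. Casselman, *Introduction to the theory of admissible representations of p-adic reductive groups* (1995), §6.3, Lemma 7.1.1.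
-/

set_option autoImplicit false
-- the mandated namespace repeats `HodgeConjecture.HodgeConjecture`, as in every `Theorems/*.lean` of this sub-problem
set_option linter.dupNamespace false

noncomputable section

open Module Representation Literature.NumberTheory.Automorphic Literature.NumberTheory.Automorphic.Zelevinsky1980 Literature.NumberTheory.GaloisRepresentations.IsNonarchimedeanLocalField
open Literature.RepresentationTheory.FiniteGroups
open scoped MatrixGroups NNReal
open Summit.HodgeConjecture.HodgeConjecture.Cruxes.H413.K2E3GL3JacquetMultiplicityAdditive (finrank_weightSpace_subrepresentation_le finrank_weightSpace_quotientRep_le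
  finiteDimensional_jacquet_subrepresentation finiteDimensional_jacquet_quotientRep finrank_weightSpace_eq_add_subrepresentation)
open Summit.HodgeConjecture.HodgeConjecture.Cruxes.H413.K2E3GL3PrincipalSeriesExhaustion (exists_finrank_weightSpace_quotientRep_ne_zero)
open Summit.HodgeConjecture.HodgeConjecture.Cruxes.H413.K2E3GL3ExponentClassTools (nontrivial_of_finrank_weightSpace_ne_zero bot_ne_top_subrepresentation exists_finrank_weightSpace_ne_zero_of_ne_bot)
open Summit.HodgeConjecture.HodgeConjecture.Cruxes.H413.K2E3GL3ExponentRules (even_finrank_weightSpace₁₂)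
open Summit.HodgeConjecture.HodgeConjecture.Cruxes.H413.K2E3GL2UnlinkedIrreducible (isIrreducible_parabolicIndGL_two_self)
open Summit.HodgeConjecture.HodgeConjecture.Cruxes.H413.K2E3GL3OneLinkNestedHighAmbient (isOpen_ker_a)
open Summit.HodgeConjecture.HodgeConjecture.Cruxes.H413.K2E3GL2JacquetModuleStructure (continuous_unitsCoe_of_isOpen_ker)
open Summit.HodgeConjecture.HodgeConjecture.Cruxes.H413.K2E3GL3OneLinkNestedLowAmbient
open Summit.HodgeConjecture.HodgeConjecture.Cruxes.H413.K2E3GL3OneLinkNestedLowConstituentA (exists_constituent_A_one)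

namespace Summit.HodgeConjecture.HodgeConjecture.Cruxes.H413.K2E3GL3OneLinkNestedLowQuotient

variable {F : Type} [Field F] [ValuativeRel F] [TopologicalSpace F] [IsNonarchimedeanLocalField F] (η : Fˣ →* ℂˣ)

set_option maxHeartbeats 1600000 in  -- one long bookkeeping proof over large weight terms (cumulative budget, as in ★ L2 ∕ ★ C2c)
/-- **A PIECE OF `S♭` WITHOUT THE WEIGHT `C` CONTRADICTS NAA♭.**  For ANY non-zero smooth `P` with finite-dimensional `r_B P` whose constituents are constituents of `S♭`
(`hPS`), whose weights are bounded by those of `S♭` (`hle`) and with `mult P C = 0`: `E(P) ⊆ {A}` with `mult P A = 1` (★ L2 table; `P` has a weight, ★ C2b-gen∕EXH pattern via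
`hPw`), so ★ L3a yields an irreducible constituent `ω` with `E(ω) = {A¹}`, admissible (★ L2) — against `hNAA`. [cite: BernsteinZelevinsky1977, Cor. 2.13, Thm. 2.9] [cite: Zelevinsky1980, §1.6] -/
theorem false_of_piece (hη : IsOpen ((η.ker : Subgroup Fˣ) : Set Fˣ))
    (h3cell : ∀ c : Fin 3 → Fin 2, Monotone c → Function.Surjective c →
      ∀ (W : Type) [AddCommGroup W] [Module ℂ W] (σ : Representation ℂ (Π a : Fin 2, GL {i : Fin 3 // c i = a} F) W),
        σ.IsIrreducible → σ.IsSmooth → σ.IsSupercuspidal →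
        ∀ (N : Subrepresentation (jacquetGL F c (Representation.parabolicIndGL F (id : Fin 3 → Fin 3) ((Representation.trivial ℂ (Π a : Fin 3, GL {i : Fin 3 // (id : Fin 3 → Fin 3) i = a} F) ℂ).twist (∏ a : Fin 3, ((![(η * ((unramifiedTwist F (1 / 2) : QuasiChar F).toMonoidHom)⁻¹), (η * ((unramifiedTwist F (1 / 2) : QuasiChar F).toMonoidHom)), (η * ((unramifiedTwist F (1 / 2) : QuasiChar F).toMonoidHom)⁻¹)] : Fin 3 → (Fˣ →* ℂˣ)) a).comp (Matrix.GeneralLinearGroup.det.comp (Pi.evalMonoidHom (fun a : Fin 3 => GL {i : Fin 3 // (id : Fin 3 → Fin 3) i = a} F) a)))))))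
          (q : N.toRepresentation.IntertwiningMap σ), q = 0)
    (hNAA : ∀ (r : SmoothIrrep (GL (Fin 3) F)), r.ρ.IsAdmissible → ∀ [FiniteDimensional ℂ (restrictUnipotentGL F (id : Fin 3 → Fin 3) r.ρ).Coinvariants],
      finrank ℂ ↥(⨅ m, Module.End.maxGenEigenspace (Representation.normalizedJacquetGL F (id : Fin 3 → Fin 3) r.ρ m) (((∏ a : Fin 3, ((![(η * ((unramifiedTwist F (1 / 2) : QuasiChar F).toMonoidHom)⁻¹), (η * ((unramifiedTwist F (1 / 2) : QuasiChar F).toMonoidHom)), (η * ((unramifiedTwist F (1 / 2) : QuasiChar F).toMonoidHom)⁻¹)] : Fin 3 → (Fˣ →* ℂˣ)) a).comp (Matrix.GeneralLinearGroup.det.comp (Pi.evalMonoidHom (fun a : Fin 3 => GL {i : Fin 3 // (id : Fin 3 → Fin 3) i = a} F) a))) m : ℂˣ) : ℂ)) = 1 →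
      (∀ ζ : (Π a : Fin 3, GL {i : Fin 3 // (id : Fin 3 → Fin 3) i = a} F) → ℂ, ζ ≠ (fun m : (Π a : Fin 3, GL {i : Fin 3 // (id : Fin 3 → Fin 3) i = a} F) => (((∏ a : Fin 3, ((![(η * ((unramifiedTwist F (1 / 2) : QuasiChar F).toMonoidHom)⁻¹), (η * ((unramifiedTwist F (1 / 2) : QuasiChar F).toMonoidHom)), (η * ((unramifiedTwist F (1 / 2) : QuasiChar F).toMonoidHom)⁻¹)] : Fin 3 → (Fˣ →* ℂˣ)) a).comp (Matrix.GeneralLinearGroup.det.comp (Pi.evalMonoidHom (fun a : Fin 3 => GL {i : Fin 3 // (id : Fin 3 → Fin 3) i = a} F) a))) m : ℂˣ) : ℂ)) → finrank ℂ ↥(⨅ m, Module.End.maxGenEigenspace (Representation.normalizedJacquetGL F (id : Fin 3 → Fin 3) r.ρ m) (ζ m)) = 0) → False)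
    (Φ : (Representation.parabolicIndGL F (![false, false, true] : Fin 3 → Bool) ((Representation.trivial ℂ (Π a : Bool, GL {i : Fin 3 // (![false, false, true] : Fin 3 → Bool) i = a} F) ℂ).twist ((η.comp (Matrix.GeneralLinearGroup.det.comp (Pi.evalMonoidHom (fun a : Bool => GL {i : Fin 3 // (![false, false, true] : Fin 3 → Bool) i = a} F) false))) * ((η * ((unramifiedTwist F (1 / 2) : QuasiChar F).toMonoidHom)⁻¹).comp (Matrix.GeneralLinearGroup.det.comp (Pi.evalMonoidHom (fun a : Bool => GL {i : Fin 3 // (![false, false, true] : Fin 3 → Bool) i = a} F) true)))))).IntertwiningMap (Representation.parabolicIndGL F (id : Fin 3 → Fin 3) ((Representation.trivial ℂ (Π a : Fin 3, GL {i : Fin 3 // (id : Fin 3 → Fin 3) i = a} F) ℂ).twist (∏ a : Fin 3, ((![(η * ((unramifiedTwist F (1 / 2) : QuasiChar F).toMonoidHom)⁻¹), (η * ((unramifiedTwist F (1 / 2) : QuasiChar F).toMonoidHom)), (η * ((unramifiedTwist F (1 / 2) : QuasiChar F).toMonoidHom)⁻¹)] : Fin 3 → (Fˣ →* ℂˣ))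 a).comp (Matrix.GeneralLinearGroup.det.comp (Pi.evalMonoidHom (fun a : Fin 3 => GL {i : Fin 3 // (id : Fin 3 → Fin 3) i = a} F) a)))))) (hΦ : Function.Injective Φ)
    {W : Type} [AddCommGroup W] [Module ℂ W] [Nontrivial W] (P : Representation ℂ (GL (Fin 3) F) W) (hP : P.IsSmooth) [FiniteDimensional ℂ (restrictUnipotentGL F (id : Fin 3 → Fin 3) P).Coinvariants]
    (hPS : ∀ r : SmoothIrrep (GL (Fin 3) F), (IrrClass.mk r).IsConstituentOf P → (IrrClass.mk r).IsConstituentOf Φ.range.quotientRep)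
    (hle : ∀ ζ : (Π a : Fin 3, GL {i : Fin 3 // (id : Fin 3 → Fin 3) i = a} F) → ℂ, finrank ℂ ↥(⨅ m, Module.End.maxGenEigenspace (Representation.normalizedJacquetGL F (id : Fin 3 → Fin 3) P m) (ζ m)) ≤ finrank ℂ ↥(⨅ m, Module.End.maxGenEigenspace (Representation.normalizedJacquetGL F (id : Fin 3 → Fin 3) Φ.range.quotientRep m) (ζ m)))
    (hPC : finrank ℂ ↥(⨅ m, Module.End.maxGenEigenspace (Representation.normalizedJacquetGL F (id : Fin 3 → Fin 3) P m) ((((∏ a : Fin 3, ((![(η * ((unramifiedTwist F (1 / 2) : QuasiChar F).toMonoidHom)), (η * ((unramifiedTwist F (1 / 2) : QuasiChar F).toMonoidHom)⁻¹), (η * ((unramifiedTwist F (1 / 2) : QuasiChar F).toMonoidHom)⁻¹)] : Fin 3 → (Fˣ →* ℂˣ)) a).comp (Matrix.GeneralLinearGroup.det.comp (Pi.evalMonoidHom (fun a : Fin 3 => GL {i : Fin 3 // (id : Fin 3 → Fin 3) i = a} F) a))) m : ℂˣ) : ℂ))) = 0) : False := by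
  haveI := finiteDimensional_jacquet_quotient η hη Φ
  have hJ : ∀ r : SmoothIrrep (GL (Fin 3) F), (IrrClass.mk r).IsConstituentOf P → Nontrivial (restrictUnipotentGL F (id : Fin 3 → Fin 3) r.ρ).Coinvariants :=
    fun r hr => nontrivial_coinvariants_of_isConstituentOf_quotient η h3cell Φ r (hPS r hr)
  have hB := finrank_weightSpace_quotient_B η hη Φ hΦ
  have hA := finrank_weightSpace_quotient_A_le η hη Φ hΦ
  have h0 := finrank_weightSpace_quotient_eq_zero η hη Φ hΦ
  -- `P` has a weight, necessarily `A`, with multiplicity exactly one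
  have h_ob := exists_finrank_weightSpace_ne_zero_of_ne_bot P hP hJ ⊤ (bot_ne_top_subrepresentation P).symm
  obtain ⟨ζ₀, hζ₀⟩ := h_ob
  have hζ₀P : finrank ℂ ↥(⨅ m, Module.End.maxGenEigenspace (Representation.normalizedJacquetGL F (id : Fin 3 → Fin 3) P m) (ζ₀ m)) ≠ 0 := by
    intro h
    have hle' := finrank_weightSpace_subrepresentation_le P hP ⊤ ζ₀
    omega
  have hP0 : ∀ ζ : (Π a : Fin 3, GL {i : Fin 3 // (id : Fin 3 → Fin 3) i = a} F) → ℂ, ζ ≠ (fun m : (Π a : Fin 3, GL {i : Fin 3 // (id : Fin 3 → Fin 3) i = a} F) => (((∏ a : Fin 3, ((![(η * ((unramifiedTwist F (1 / 2) : QuasiChar F).toMonoidHom)⁻¹), (η * ((unramifiedTwist F (1 / 2) : QuasiChar F).toMonoidHom)), (η * ((unramifiedTwist F (1 / 2) : QuasiChar F).toMonoidHom)⁻¹)] : Fin 3 → (Fˣ →* ℂˣ)) a).comp (Matrix.GeneralLinearGroup.det.comp (Pi.evalMonoidHom (fun a : Fin 3 => GL {i : Fin 3 // (id : Fin 3 →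 Fin 3) i = a} F) a))) m : ℂˣ) : ℂ)) →
      finrank ℂ ↥(⨅ m, Module.End.maxGenEigenspace (Representation.normalizedJacquetGL F (id : Fin 3 → Fin 3) P m) (ζ m)) = 0 := by
    intro ζ hζA
    by_cases hζB : ζ = (fun m : (Π a : Fin 3, GL {i : Fin 3 // (id : Fin 3 → Fin 3) i = a} F) => (((∏ a : Fin 3, ((![(η * ((unramifiedTwist F (1 / 2) : QuasiChar F).toMonoidHom)⁻¹), (η * ((unramifiedTwist F (1 / 2) : QuasiChar F).toMonoidHom)⁻¹), (η * ((unramifiedTwist F (1 / 2) : QuasiChar F).toMonoidHom))] : Fin 3 → (Fˣ →* ℂˣ)) a).comp (Matrix.GeneralLinearGroup.det.comp (Pi.evalMonoidHom (fun a : Fin 3 => GL {i : Fin 3 // (id : Fin 3 → Fin 3) i = a} F) a))) m : ℂˣ) : ℂ))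
    · subst hζB
      have h1 := hle (fun m : (Π a : Fin 3, GL {i : Fin 3 // (id : Fin 3 → Fin 3) i = a} F) => (((∏ a : Fin 3, ((![(η * ((unramifiedTwist F (1 / 2) : QuasiChar F).toMonoidHom)⁻¹), (η * ((unramifiedTwist F (1 / 2) : QuasiChar F).toMonoidHom)⁻¹), (η * ((unramifiedTwist F (1 / 2) : QuasiChar F).toMonoidHom))] : Fin 3 → (Fˣ →* ℂˣ)) a).comp (Matrix.GeneralLinearGroup.det.comp (Pi.evalMonoidHom (fun a : Fin 3 => GL {i : Fin 3 // (id : Fin 3 → Fin 3) i = a} F) a))) m : ℂˣ) : ℂ))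
      beta_reduce at h1 ⊢
      omega
    by_cases hζC : ζ = (fun m : (Π a : Fin 3, GL {i : Fin 3 // (id : Fin 3 → Fin 3) i = a} F) => (((∏ a : Fin 3, ((![(η * ((unramifiedTwist F (1 / 2) : QuasiChar F).toMonoidHom)), (η * ((unramifiedTwist F (1 / 2) : QuasiChar F).toMonoidHom)⁻¹), (η * ((unramifiedTwist F (1 / 2) : QuasiChar F).toMonoidHom)⁻¹)] : Fin 3 → (Fˣ →* ℂˣ)) a).comp (Matrix.GeneralLinearGroup.det.comp (Pi.evalMonoidHom (fun a : Fin 3 => GL {i : Fin 3 // (id : Fin 3 → Fin 3) i = a} F) a))) m : ℂˣ) : ℂ))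
    · subst hζC
      beta_reduce
      exact hPC
    · have h1 := hle ζ
      have h2 := h0 ζ hζA hζB hζC
      omega
  have hζA : ζ₀ = (fun m : (Π a : Fin 3, GL {i : Fin 3 // (id : Fin 3 → Fin 3) i = a} F) => (((∏ a : Fin 3, ((![(η * ((unramifiedTwist F (1 / 2) : QuasiChar F).toMonoidHom)⁻¹), (η * ((unramifiedTwist F (1 / 2) : QuasiChar F).toMonoidHom)), (η * ((unramifiedTwist F (1 / 2) : QuasiChar F).toMonoidHom)⁻¹)] : Fin 3 → (Fˣ →* ℂˣ)) a).comp (Matrix.GeneralLinearGroup.det.comp (Pi.evalMonoidHom (fun a : Fin 3 => GL {i : Fin 3 // (id : Fin 3 → Fin 3) i = a} F) a))) m : ℂˣ) : ℂ)) := by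
    by_contra hne
    exact hζ₀P (hP0 ζ₀ hne)
  subst hζA
  have hPA : finrank ℂ ↥(⨅ m, Module.End.maxGenEigenspace (Representation.normalizedJacquetGL F (id : Fin 3 → Fin 3) P m) ((((∏ a : Fin 3, ((![(η * ((unramifiedTwist F (1 / 2) : QuasiChar F).toMonoidHom)⁻¹), (η * ((unramifiedTwist F (1 / 2) : QuasiChar F).toMonoidHom)), (η * ((unramifiedTwist F (1 / 2) : QuasiChar F).toMonoidHom)⁻¹)] : Fin 3 → (Fˣ →* ℂˣ)) a).comp (Matrix.GeneralLinearGroup.det.comp (Pi.evalMonoidHom (fun a : Fin 3 => GL {i : Fin 3 // (id : Fin 3 → Fin 3) i = a} F) a))) m : ℂˣ) : ℂ))) = 1 := by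
    have h1 := hle (fun m : (Π a : Fin 3, GL {i : Fin 3 // (id : Fin 3 → Fin 3) i = a} F) => (((∏ a : Fin 3, ((![(η * ((unramifiedTwist F (1 / 2) : QuasiChar F).toMonoidHom)⁻¹), (η * ((unramifiedTwist F (1 / 2) : QuasiChar F).toMonoidHom)), (η * ((unramifiedTwist F (1 / 2) : QuasiChar F).toMonoidHom)⁻¹)] : Fin 3 → (Fˣ →* ℂˣ)) a).comp (Matrix.GeneralLinearGroup.det.comp (Pi.evalMonoidHom (fun a : Fin 3 => GL {i : Fin 3 // (id : Fin 3 → Fin 3) i = a} F) a))) m : ℂˣ) : ℂ))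
    beta_reduce at h1 hζ₀P
    omega
  have h_ob2 := exists_constituent_A_one η P hP hJ hPA hP0
  obtain ⟨r, hr, hfd, hrA, hr0⟩ := h_ob2
  haveI := hfd
  exact hNAA r (isAdmissible_of_isConstituentOf_quotient η hη Φ r (hPS r hr)) hrA hr0

set_option maxHeartbeats 1600000 in  -- one long bookkeeping proof over large weight terms (cumulative budget, as in ★ L2 ∕ ★ C2c)
/-- **S0IRR♭ — `S♭ = I(A) ⁄ Φ(D♭)` IS IRREDUCIBLE** under `h3cell` (three-cell socket) and NAA♭ (`hNAA`).  For `⊥ ≠ N ≠ ⊤`: `mult_N C`, `mult_{S♭⁄N} C` are even (★ H0 parity (1,2),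
★ GL2-UNL) with sum `mult S♭ C = 2` (★ ADD, ★ L2), so one piece has no `C` — `false_of_piece`. [cite: BernsteinZelevinsky1977, Cor. 2.13, Thm. 2.9] [cite: Zelevinsky1980, §1.6, Thm. 4.2]
[cite: Casselman1995, Lemma 7.1.1] -/
theorem isIrreducible_quotient (hη : IsOpen ((η.ker : Subgroup Fˣ) : Set Fˣ))
    (h3cell : ∀ c : Fin 3 → Fin 2, Monotone c → Function.Surjective c →
      ∀ (W : Type) [AddCommGroup W] [Module ℂ W] (σ : Representation ℂ (Π a : Fin 2, GL {i : Fin 3 // c i = a} F) W),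
        σ.IsIrreducible → σ.IsSmooth → σ.IsSupercuspidal →
        ∀ (N : Subrepresentation (jacquetGL F c (Representation.parabolicIndGL F (id : Fin 3 → Fin 3) ((Representation.trivial ℂ (Π a : Fin 3, GL {i : Fin 3 // (id : Fin 3 → Fin 3) i = a} F) ℂ).twist (∏ a : Fin 3, ((![(η * ((unramifiedTwist F (1 / 2) : QuasiChar F).toMonoidHom)⁻¹), (η * ((unramifiedTwist F (1 / 2) : QuasiChar F).toMonoidHom)), (η * ((unramifiedTwist F (1 / 2) : QuasiChar F).toMonoidHom)⁻¹)] : Fin 3 → (Fˣ →* ℂˣ)) a).comp (Matrix.GeneralLinearGroup.det.comp (Pi.evalMonoidHom (fun a : Fin 3 => GL {i : Fin 3 // (id : Fin 3 → Fin 3) i = a} F) a)))))))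
          (q : N.toRepresentation.IntertwiningMap σ), q = 0)
    (hNAA : ∀ (r : SmoothIrrep (GL (Fin 3) F)), r.ρ.IsAdmissible → ∀ [FiniteDimensional ℂ (restrictUnipotentGL F (id : Fin 3 → Fin 3) r.ρ).Coinvariants],
      finrank ℂ ↥(⨅ m, Module.End.maxGenEigenspace (Representation.normalizedJacquetGL F (id : Fin 3 → Fin 3) r.ρ m) (((∏ a : Fin 3, ((![(η * ((unramifiedTwist F (1 / 2) : QuasiChar F).toMonoidHom)⁻¹), (η * ((unramifiedTwist F (1 / 2) : QuasiChar F).toMonoidHom)), (η * ((unramifiedTwist F (1 / 2) : QuasiChar F).toMonoidHom)⁻¹)] : Fin 3 → (Fˣ →* ℂˣ)) a).comp (Matrix.GeneralLinearGroup.det.comp (Pi.evalMonoidHom (fun a : Fin 3 => GL {i : Fin 3 // (id : Fin 3 → Fin 3) i = a} F) a))) m : ℂˣ) : ℂ)) = 1 →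
      (∀ ζ : (Π a : Fin 3, GL {i : Fin 3 // (id : Fin 3 → Fin 3) i = a} F) → ℂ, ζ ≠ (fun m : (Π a : Fin 3, GL {i : Fin 3 // (id : Fin 3 → Fin 3) i = a} F) => (((∏ a : Fin 3, ((![(η * ((unramifiedTwist F (1 / 2) : QuasiChar F).toMonoidHom)⁻¹), (η * ((unramifiedTwist F (1 / 2) : QuasiChar F).toMonoidHom)), (η * ((unramifiedTwist F (1 / 2) : QuasiChar F).toMonoidHom)⁻¹)] : Fin 3 → (Fˣ →* ℂˣ)) a).comp (Matrix.GeneralLinearGroup.det.comp (Pi.evalMonoidHom (fun a : Fin 3 => GL {i : Fin 3 // (id : Fin 3 → Fin 3) i = a} F) a))) m : ℂˣ) : ℂ)) → finrank ℂ ↥(⨅ m, Module.End.maxGenEigenspace (Representation.normalizedJacquetGL F (id : Fin 3 → Fin 3) r.ρ m) (ζ m)) = 0) → False)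
    (Φ : (Representation.parabolicIndGL F (![false, false, true] : Fin 3 → Bool) ((Representation.trivial ℂ (Π a : Bool, GL {i : Fin 3 // (![false, false, true] : Fin 3 → Bool) i = a} F) ℂ).twist ((η.comp (Matrix.GeneralLinearGroup.det.comp (Pi.evalMonoidHom (fun a : Bool => GL {i : Fin 3 // (![false, false, true] : Fin 3 → Bool) i = a} F) false))) * ((η * ((unramifiedTwist F (1 / 2) : QuasiChar F).toMonoidHom)⁻¹).comp (Matrix.GeneralLinearGroup.det.comp (Pi.evalMonoidHom (fun a : Bool => GL {i : Fin 3 // (![false, false, true] : Fin 3 → Bool) i = a} F) true)))))).IntertwiningMap (Representation.parabolicIndGL F (id : Fin 3 → Fin 3) ((Representation.trivial ℂ (Π a : Fin 3, GL {i : Fin 3 // (id : Fin 3 → Fin 3) i = a} F) ℂ).twist (∏ a : Fin 3, ((![(η * ((unramifiedTwist F (1 / 2) : QuasiChar F).toMonoidHom)⁻¹), (η * ((unramifiedTwist F (1 / 2) : QuasiChar F).toMonoidHom)), (η * ((unramifiedTwist F (1 / 2) : QuasiChar F).toMonoidHom)⁻¹)] : Fin 3 → (Fˣ →* ℂˣ))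 a).comp (Matrix.GeneralLinearGroup.det.comp (Pi.evalMonoidHom (fun a : Fin 3 => GL {i : Fin 3 // (id : Fin 3 → Fin 3) i = a} F) a)))))) (hΦ : Function.Injective Φ) :
    (Φ.range.quotientRep).IsIrreducible := by
  haveI : IsTopologicalRing F := inferInstance
  have hIs := isSmooth_quotient η Φ
  haveI := finiteDimensional_jacquet_quotient η hη Φ
  have hJ : ∀ r : SmoothIrrep (GL (Fin 3) F), (IrrClass.mk r).IsConstituentOf Φ.range.quotientRep → Nontrivial (restrictUnipotentGL F (id : Fin 3 → Fin 3) r.ρ).Coinvariants :=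
    fun r hr => nontrivial_coinvariants_of_isConstituentOf_quotient η h3cell Φ r hr
  have hC := finrank_weightSpace_quotient_C η hη Φ hΦ
  have hC0 : finrank ℂ ↥(⨅ m, Module.End.maxGenEigenspace (Representation.normalizedJacquetGL F (id : Fin 3 → Fin 3) Φ.range.quotientRep m) ((((∏ a : Fin 3, ((![(η * ((unramifiedTwist F (1 / 2) : QuasiChar F).toMonoidHom)), (η * ((unramifiedTwist F (1 / 2) : QuasiChar F).toMonoidHom)⁻¹), (η * ((unramifiedTwist F (1 / 2) : QuasiChar F).toMonoidHom)⁻¹)] : Fin 3 → (Fˣ →* ℂˣ)) a).comp (Matrix.GeneralLinearGroup.det.comp (Pi.evalMonoidHom (fun a : Fin 3 => GL {i : Fin 3 // (id : Fin 3 → Fin 3) i = a} F) a))) m : ℂˣ) : ℂ))) ≠ 0 := by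
    rw [hC]; exact two_ne_zero
  haveI := nontrivial_of_finrank_weightSpace_ne_zero (Φ.range.quotientRep) (fun m : (Π a : Fin 3, GL {i : Fin 3 // (id : Fin 3 → Fin 3) i = a} F) => (((∏ a : Fin 3, ((![(η * ((unramifiedTwist F (1 / 2) : QuasiChar F).toMonoidHom)), (η * ((unramifiedTwist F (1 / 2) : QuasiChar F).toMonoidHom)⁻¹), (η * ((unramifiedTwist F (1 / 2) : QuasiChar F).toMonoidHom)⁻¹)] : Fin 3 → (Fˣ →* ℂˣ)) a).comp (Matrix.GeneralLinearGroup.det.comp (Pi.evalMonoidHom (fun a : Fin 3 => GL {i : Fin 3 // (id : Fin 3 → Fin 3) i = a} F) a))) m : ℂˣ) : ℂ)) hC0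
  refine { exists_pair_ne := ⟨⊥, ⊤, bot_ne_top_subrepresentation _⟩, eq_bot_or_eq_top := fun N => ?_ }
  by_contra hN
  push Not at hN
  -- the two pieces
  haveI := finiteDimensional_jacquet_subrepresentation (Φ.range.quotientRep) monotone_id hIs N
  haveI := finiteDimensional_jacquet_quotientRep (c := (id : Fin 3 → Fin 3)) (Φ.range.quotientRep) N
  have ha : IsOpen (((((η * ((unramifiedTwist F (1 / 2) : QuasiChar F).toMonoidHom)⁻¹))).ker : Subgroup Fˣ) : Set Fˣ) := isOpen_ker_a η hη
  have hirr := isIrreducible_parabolicIndGL_two_self (η * ((unramifiedTwist F (1 / 2) : QuasiChar F).toMonoidHom)⁻¹) (continuous_unitsCoe_of_isOpen_ker _ ha)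
  have hevN := even_finrank_weightSpace₁₂ N.toRepresentation (hIs.toRepresentation N) (η * ((unramifiedTwist F (1 / 2) : QuasiChar F).toMonoidHom)) (η * ((unramifiedTwist F (1 / 2) : QuasiChar F).toMonoidHom)⁻¹) ha hirr
  have hevQ := even_finrank_weightSpace₁₂ N.quotientRep (hIs.quotientRep N) (η * ((unramifiedTwist F (1 / 2) : QuasiChar F).toMonoidHom)) (η * ((unramifiedTwist F (1 / 2) : QuasiChar F).toMonoidHom)⁻¹) ha hirr
  have hadd := finrank_weightSpace_eq_add_subrepresentation (Φ.range.quotientRep) hIs N (fun m : (Π a : Fin 3, GL {i : Fin 3 // (id : Fin 3 → Fin 3) i = a} F) => (((∏ a : Fin 3, ((![(η * ((unramifiedTwist F (1 / 2) : QuasiChar F).toMonoidHom)), (η * ((unramifiedTwist F (1 / 2) : QuasiChar F).toMonoidHom)⁻¹), (η * ((unramifiedTwist F (1 / 2) : QuasiChar F).toMonoidHom)⁻¹)] : Fin 3 → (Fˣ →* ℂˣ)) a).comp (Matrix.GeneralLinearGroup.det.comp (Pi.evalMonoidHom (fun a : Fin 3 => GL {i : Fin 3 // (id : Fin 3 → Fin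 3) i = a} F) a))) m : ℂˣ) : ℂ))
  beta_reduce at hadd hC
  obtain ⟨k₁, hk₁⟩ := hevN
  obtain ⟨k₂, hk₂⟩ := hevQ
  -- restate in one spelling (the instantiated ★ lemmas carry their own instance paths)
  have h2 : finrank ℂ ↥(⨅ m, Module.End.maxGenEigenspace (Representation.normalizedJacquetGL F (id : Fin 3 → Fin 3) N.toRepresentation m) ((((∏ a : Fin 3, ((![(η * ((unramifiedTwist F (1 / 2) : QuasiChar F).toMonoidHom)), (η * ((unramifiedTwist F (1 / 2) : QuasiChar F).toMonoidHom)⁻¹), (η * ((unramifiedTwist F (1 / 2) : QuasiChar F).toMonoidHom)⁻¹)] : Fin 3 → (Fˣ →* ℂˣ)) a).comp (Matrix.GeneralLinearGroup.det.comp (Pi.evalMonoidHom (fun a : Fin 3 => GL {i : Fin 3 // (id : Fin 3 → Fin 3) i = a} F) a))) m : ℂˣ) : ℂ))) +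
      finrank ℂ ↥(⨅ m, Module.End.maxGenEigenspace (Representation.normalizedJacquetGL F (id : Fin 3 → Fin 3) N.quotientRep m) ((((∏ a : Fin 3, ((![(η * ((unramifiedTwist F (1 / 2) : QuasiChar F).toMonoidHom)), (η * ((unramifiedTwist F (1 / 2) : QuasiChar F).toMonoidHom)⁻¹), (η * ((unramifiedTwist F (1 / 2) : QuasiChar F).toMonoidHom)⁻¹)] : Fin 3 → (Fˣ →* ℂˣ)) a).comp (Matrix.GeneralLinearGroup.det.comp (Pi.evalMonoidHom (fun a : Fin 3 => GL {i : Fin 3 // (id : Fin 3 → Fin 3) i = a} F) a))) m : ℂˣ) : ℂ))) = 2 := hadd.symm.trans hC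
  have hk₁' : finrank ℂ ↥(⨅ m, Module.End.maxGenEigenspace (Representation.normalizedJacquetGL F (id : Fin 3 → Fin 3) N.toRepresentation m) ((((∏ a : Fin 3, ((![(η * ((unramifiedTwist F (1 / 2) : QuasiChar F).toMonoidHom)), (η * ((unramifiedTwist F (1 / 2) : QuasiChar F).toMonoidHom)⁻¹), (η * ((unramifiedTwist F (1 / 2) : QuasiChar F).toMonoidHom)⁻¹)] : Fin 3 → (Fˣ →* ℂˣ)) a).comp (Matrix.GeneralLinearGroup.det.comp (Pi.evalMonoidHom (fun a : Fin 3 => GL {i : Fin 3 // (id : Fin 3 → Fin 3) i = a} F) a))) m : ℂˣ) : ℂ))) = k₁ + k₁ := hk₁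
  have hk₂' : finrank ℂ ↥(⨅ m, Module.End.maxGenEigenspace (Representation.normalizedJacquetGL F (id : Fin 3 → Fin 3) N.quotientRep m) ((((∏ a : Fin 3, ((![(η * ((unramifiedTwist F (1 / 2) : QuasiChar F).toMonoidHom)), (η * ((unramifiedTwist F (1 / 2) : QuasiChar F).toMonoidHom)⁻¹), (η * ((unramifiedTwist F (1 / 2) : QuasiChar F).toMonoidHom)⁻¹)] : Fin 3 → (Fˣ →* ℂˣ)) a).comp (Matrix.GeneralLinearGroup.det.comp (Pi.evalMonoidHom (fun a : Fin 3 => GL {i : Fin 3 // (id : Fin 3 → Fin 3) i = a} F) a))) m : ℂˣ) : ℂ))) = k₂ + k₂ := hk₂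
  have hcases : finrank ℂ ↥(⨅ m, Module.End.maxGenEigenspace (Representation.normalizedJacquetGL F (id : Fin 3 → Fin 3) N.toRepresentation m) ((((∏ a : Fin 3, ((![(η * ((unramifiedTwist F (1 / 2) : QuasiChar F).toMonoidHom)), (η * ((unramifiedTwist F (1 / 2) : QuasiChar F).toMonoidHom)⁻¹), (η * ((unramifiedTwist F (1 / 2) : QuasiChar F).toMonoidHom)⁻¹)] : Fin 3 → (Fˣ →* ℂˣ)) a).comp (Matrix.GeneralLinearGroup.det.comp (Pi.evalMonoidHom (fun a : Fin 3 => GL {i : Fin 3 // (id : Fin 3 → Fin 3) i = a} F) a))) m : ℂˣ) : ℂ))) = 0 ∨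
      finrank ℂ ↥(⨅ m, Module.End.maxGenEigenspace (Representation.normalizedJacquetGL F (id : Fin 3 → Fin 3) N.quotientRep m) ((((∏ a : Fin 3, ((![(η * ((unramifiedTwist F (1 / 2) : QuasiChar F).toMonoidHom)), (η * ((unramifiedTwist F (1 / 2) : QuasiChar F).toMonoidHom)⁻¹), (η * ((unramifiedTwist F (1 / 2) : QuasiChar F).toMonoidHom)⁻¹)] : Fin 3 → (Fˣ →* ℂˣ)) a).comp (Matrix.GeneralLinearGroup.det.comp (Pi.evalMonoidHom (fun a : Fin 3 => GL {i : Fin 3 // (id : Fin 3 → Fin 3) i = a} F) a))) m : ℂˣ) : ℂ))) = 0 := by omega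
  rcases hcases with hNC | hQC
  · -- the piece `N`
    have h_ob := exists_finrank_weightSpace_ne_zero_of_ne_bot (Φ.range.quotientRep) hIs hJ N hN.1
    obtain ⟨ζ₁, hζ₁⟩ := h_ob
    haveI := nontrivial_of_finrank_weightSpace_ne_zero N.toRepresentation ζ₁ hζ₁
    exact false_of_piece η hη h3cell hNAA Φ hΦ N.toRepresentation (hIs.toRepresentation N) (fun r hr => hr.of_subrepresentation N)
      (fun ζ => finrank_weightSpace_subrepresentation_le (Φ.range.quotientRep) hIs N ζ) hNC
  · -- the piece `S♭ ⁄ N`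
    have h_ob := exists_finrank_weightSpace_quotientRep_ne_zero (Φ.range.quotientRep) hIs hJ N hN.2
    obtain ⟨ζ₂, hζ₂⟩ := h_ob
    haveI := nontrivial_of_finrank_weightSpace_ne_zero N.quotientRep ζ₂ hζ₂
    exact false_of_piece η hη h3cell hNAA Φ hΦ N.quotientRep (hIs.quotientRep N) (fun r hr => hr.of_quotientRep N)
      (fun ζ => finrank_weightSpace_quotientRep_le (Φ.range.quotientRep) hIs N ζ) hQC

end Summit.HodgeConjecture.HodgeConjecture.Cruxes.H413.K2E3GL3OneLinkNestedLowQuotient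

end
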